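import Summits.QuantumFields.BalabanUV.T4Continuum.Support.NE7CornerCostFar
import Summits.QuantumFields.BalabanUV.T4Continuum.Support.NE7SliceGreenTorusLocalised
import Summits.QuantumFields.BalabanUV.T4Continuum.Support.NE7SliceGreenFlat
import HarnessLib

/-!
# NE7SliceGreenPairingLocalised — THE TWO-REGION ENTRY PAIRING BOUND for the localised slice solver letter: for a skew periodic `X` whose flat Hessian is bounded on skew
# periodic flat tangents by `a‖Y‖_{1,Bn} + b‖Y‖_{1,Bf}` (`Bf` = sites whose block is at torus block-distance `≥ ℓ + nbRad + 1` from a centre), the twisted entry pairing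
# against a `ker Q_k` torus test field `a′` obeys `|Re(c̄·S)| ≤ (card n)²·C₄·(a‖a′‖₁ + b‖a′|_{far(ℓ)}‖₁)`, `C₄ = 1 + 4(d+1)²L` — G3 §1 with F254a's LOCAL corrector and F254b's
# far corner cost

Cell `pub-balaban`, rung (B)+1 sub-cell t4, lineage `b2b-balaban-t4-ne7-p1` (CRUX PROVER NE7 #1 = OWNER of row NE7), generation 89; memo
`t4/b2b-balaban-t4-ne7-p1-g89/COSTING-N1.md` §5 (1).  File F254c (between F254b `NE7CornerCostFar` and the END F254d `NE7SliceGreenFlatLocalised`).  Over F254a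
`NE7TangentCorrectorLocal.exists_tangent_of_straight_zero_local`, F254b `NE7CornerCostFar.corner_cost_far_le ∕ rep_blockOf_toT`, G3a `NE7SliceGreenTestField`
(`isSkewDir_test`, `isPeriodicDir_test`, `norm_test_le`, `Qcoarse_iterate_test_eq_zero`, `hess_flat_test`, `Fs_one_smul`), F38 `NE7ApeFlatSkeleton.hess_flat`,
`NE7TorusBoxDictionary.sum_periodBox_toT ∕ periodBox_eq_pbox`, lit-balaban's `B6LowerBound2153Torus.sum_pbox_toT`.

WHY.  G3 `NE7SliceGreenFlat.abs_re_pairing_le` reads the GLOBAL `(ℓ¹)*` hypothesis on the tangent-corrected test direction; the localised letter (F252's `hGloc`) has a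
TWO-REGION hypothesis, and the far density must stay attached to far test fields: the near norm is bounded globally (the whole period box is «far at threshold
−(nbRad+1)»), the far norm by the far mass of the test direction plus F254b's far corner cost, and the far mass of the test direction `Y^{a′}` is read on the torus as
the mass of `a′` on the far bond set (`sum_far_norm_pull_eq`).
WHAT ([folklore] composition; 0 def, 0 sorry; dimension `d + 1 ≥ 2`, `L ≥ 2`).  §1 `sum_far_norm_pull_eq`, **`abs_re_pairing_le_localised`**.
HONEST FRAMING (page 1): a composition of tree theorems at `U = 1`; nothing printed is asserted; NOT (APE), NOT ONE-STEP, NOT NE7; spine 0∕9; finite T⁴ rung (B)+1 — NOT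
infinite volume, NOT mass gap, NOT `BetaPertH`, NOT Clay.  Continuum YM on T⁴ ⇐ BetaPertH ∧ nine spine estimates (0/9 proved); BetaPertH ⇐ (D1) ∧ (D4) ∧ CAP+tail;
G-an2-4 gates asym, D1 and NE2/3/4.
-/

set_option autoImplicit false

open scoped BigOperators Matrix ComplexConjugate Matrix.Norms.L2Operator
open Finset

namespace Summit.QuantumFields.BalabanUV.T4Continuum.NE7SliceGreenPairingLocalised

open Literature.MathematicalPhysics.QuantumFieldTheory.Balaban1983to89
open B7Prop1Explicit (Site e e_apply)
open T4AveragingDeficitWall (curlAt curl IsSkewDir SmallField dirL1)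
open T4AveragingDeficitWallBoundary (periodBox mem_periodBox)
open AveragingDeficitPeriodicCounting (IsPeriodicDir)
open BlockAverageVaryHolo (nbRad)
open B5Prop11Plancherel (Tor fine unitVec)
open B5Action121 (Fs Fs_apply CurlOp CurlOp_mulVec)
open B5Block118 (QvOp bpt)
open B5Blocks16 (blockOf blockOf_bpt)
open B6LowerBound2153Torus (toT rep toT_rep sum_pbox_toT)
open B4TorusKernel.MultiPeriod (torusSupNorm torusSupNorm_nonneg)
open BlockAveragePushDirSplit (flat)
open NE3TangentFlatStructure (framePot)
open NE3TangentCovariantTower (dirIter)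
open NE3FlatHessianCurl (smallField_flatCfg_zero)
open NE3TangentFlatPush (flatCfg_eq_flat)
open NE3HessForm (hess)
open MinimalActionLevels (perWin)
open NE7ApeFlatSkeleton (hess_flat)
open NE7FlatHkOrthogonal (Fs_eq_mul_Fs_one)
open NE7FlatHkCurlLetter (opNorm_le_card_mul)
open NE7TorusBoxDictionary (curlAt_flat_entry_torus sum_periodBox_toT periodBox_eq_pbox)
open NE7SliceGreenFlat (exists_kerQ_entry)
open NE7SliceGreenTestField (Fs_one_smul isSkewDir_test isPeriodicDir_test norm_test_le Qcoarse_iterate_test_eq_zero hess_flat_test curl_pairing_eq)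
open NE7TangentCorrectorLocal (exists_tangent_of_straight_zero_local)
open NE7CornerCostFar (corner_cost_far_le rep_blockOf_toT)
open NE7SliceGreenTorusLocalised (exists_sliceGreen_localised_const)
open Beta.FluctuationProjection (digitOf bpt_blockOf_digitOf)

noncomputable section

variable {d : ℕ} {n : Type*} [Fintype n] [DecidableEq n]

/-! ## §1 The real part of the twisted entry pairing, two-region -/

/-- far fine sites of the period box ↔ far torus bonds: `Σ_{x ∈ [0,MN)^{d+1}, ℓ ≤ |⌊x∕M⌋ − c|_T} Σ_κ |a(x̄,κ)| = Σ_{(t,κ) : ℓ ≤ |rep(blockOf t) − c|_T} |a(t,κ)|`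
(F254b `rep_blockOf_toT`, `sum_periodBox_toT`). [folklore] -/
theorem sum_far_norm_pull_eq (M N : ℕ) [NeZero M] [NeZero N] (a : Tor (fine M (fun _ : Fin (d + 1) => N)) × Fin (d + 1) → ℂ)
    (c : Site (d + 1)) (ℓ : ℝ) :
    ∑ x ∈ (periodBox (d := d + 1) (M * N)).filter (fun x => ℓ ≤ torusSupNorm (fun _ : Fin (d + 1) => N) ((fun i => x i / (M : ℤ)) - c)),
        ∑ κ : Fin (d + 1), ‖a (toT (fine M (fun _ : Fin (d + 1) => N)) x, κ)‖
      = ∑ j ∈ (Finset.univ : Finset (Tor (fine M (fun _ : Fin (d + 1) => N)) × Fin (d + 1))).filter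
          (fun j => ℓ ≤ torusSupNorm (fun _ : Fin (d + 1) => N) (rep (fun _ : Fin (d + 1) => N) (B5Blocks16.blockOf M (fun _ : Fin (d + 1) => N) j.1) - c)), ‖a j‖ := by
  classical
  rw [Finset.sum_filter, Finset.sum_filter]
  -- the torus-side summand
  set g : Tor (fine M (fun _ : Fin (d + 1) => N)) → ℝ := fun t =>
    if ℓ ≤ torusSupNorm (fun _ : Fin (d + 1) => N) (rep (fun _ : Fin (d + 1) => N) (B5Blocks16.blockOf M (fun _ : Fin (d + 1) => N) t) - c)
    then ∑ κ : Fin (d + 1), ‖a (t, κ)‖ else 0 with hg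
  -- read the block of `x` on the torus
  have h1 : ∑ x ∈ periodBox (d := d + 1) (M * N),
      (if ℓ ≤ torusSupNorm (fun _ : Fin (d + 1) => N) ((fun i => x i / (M : ℤ)) - c) then ∑ κ : Fin (d + 1), ‖a (toT (fine M (fun _ : Fin (d + 1) => N)) x, κ)‖ else 0)
      = ∑ x ∈ periodBox (d := d + 1) (M * N), g (toT (fine M (fun _ : Fin (d + 1) => N)) x) := by
    refine Finset.sum_congr rfl fun x hx => ?_
    rw [hg]
    simp only [rep_blockOf_toT M N x hx]
  have h2 : ∑ x ∈ periodBox (d := d + 1) (M * N), g (toT (fine M (fun _ : Fin (d + 1) => N)) x) = ∑ t : Tor (fine M (fun _ : Fin (d + 1) => N)), g t := by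
    rw [periodBox_eq_pbox]
    exact sum_pbox_toT (fine M (fun _ : Fin (d + 1) => N)) g
  rw [h1, h2, Fintype.sum_prod_type]
  refine Finset.sum_congr rfl fun t _ => ?_
  by_cases hc : ℓ ≤ torusSupNorm (fun _ : Fin (d + 1) => N) (rep (fun _ : Fin (d + 1) => N) (B5Blocks16.blockOf M (fun _ : Fin (d + 1) => N) t) - c)
  · simp [hg, hc]
  · simp [hg, hc]

/-- **`|Re(c̄·S)| ≤ (card n)²·C₄·(a·‖a′‖₁ + b·‖a′|_{far}‖₁)`**, `C₄ = 1 + 2(d+1)·2(d+1)L` — G3 §1 with the two-region hypothesis: the test direction `Y^{c·a′}_{ii′}`, F254a's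
LOCAL corrector, the hypothesis on the corrected direction, the near norm bounded globally and the far norm by F254b's far corner cost + the pointwise size of the test
direction, read on the torus by `sum_far_norm_pull_eq`. [folklore] -/
theorem abs_re_pairing_le_localised [Nonempty n] (hd : 1 ≤ d) {L : ℕ} (hL : 2 ≤ L) (k N : ℕ) [NeZero N] [NeZero (L ^ (k + 1))] [NeZero (L ^ (k + 1) * N)]
    {X : Site (d + 1) → Fin (d + 1) → Matrix n n ℂ} (hXs : IsSkewDir X) (hXP : IsPeriodicDir X ((L ^ (k + 1) * N : ℕ) : ℤ))
    (cS : Site (d + 1)) (ℓ : ℝ) (Bn Bf : Finset (Site (d + 1))) (hBn : Bn ⊆ periodBox (d := d + 1) (L ^ (k + 1) * N))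
    (hBf : Bf ⊆ periodBox (d := d + 1) (L ^ (k + 1) * N))
    (hfar : ∀ x ∈ Bf, ℓ + nbRad (d + 1) L + 1 ≤ torusSupNorm (fun _ : Fin (d + 1) => N) ((fun i => x i / ((L ^ (k + 1) : ℕ) : ℤ)) - cS))
    {a b : ℝ} (ha : 0 ≤ a) (hb : 0 ≤ b)
    (hsrc : ∀ Y : Site (d + 1) → Fin (d + 1) → Matrix n n ℂ, IsSkewDir Y → IsPeriodicDir Y ((L ^ (k + 1) * N : ℕ) : ℤ) →
      dirIter L (k + 1) (flat (d := d + 1) (n := n)) Y = 0 →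
      |hess (flat (d := d + 1) (n := n)) X Y (perWin (d + 1) (L ^ (k + 1) * N))| ≤ a * dirL1 Y Bn + b * dirL1 Y Bf)
    (a' : Tor (fine (L ^ (k + 1)) (fun _ : Fin (d + 1) => N)) × Fin (d + 1) → ℂ) (ha' : QvOp (L ^ (k + 1)) (fun _ : Fin (d + 1) => N) *ᵥ a' = 0)
    (c : ℂ) (hc : ‖c‖ = 1) (i i' : n) :
    |(conj c * ∑ p ∈ perWin (d + 1) (L ^ (k + 1) * N),
        conj (Fs (fun _ : Fin (d + 1) => L ^ (k + 1) * N) 1 a' p.2.1.1 p.2.1.2 (toT (fun _ : Fin (d + 1) => L ^ (k + 1) * N) p.1))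
          * Fs (fun _ : Fin (d + 1) => L ^ (k + 1) * N) 1
              (fun q : Tor (fun _ : Fin (d + 1) => L ^ (k + 1) * N) × Fin (d + 1) => X (rep (fun _ : Fin (d + 1) => L ^ (k + 1) * N) q.1) q.2 i i')
              p.2.1.1 p.2.1.2 (toT (fun _ : Fin (d + 1) => L ^ (k + 1) * N) p.1)).re|
      ≤ (Fintype.card n : ℝ) ^ 2 * (1 + 2 * ((d + 1 : ℕ) : ℝ) * (2 * ((((d + 1 : ℕ) : ℝ)) * L)))
          * (a * ∑ j, ‖a' j‖
            + b * ∑ j ∈ (Finset.univ : Finset (Tor (fine (L ^ (k + 1)) (fun _ : Fin (d + 1) => N)) × Fin (d + 1))).filter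
                (fun j => ℓ ≤ torusSupNorm (fun _ : Fin (d + 1) => N)
                  (rep (fun _ : Fin (d + 1) => N) (B5Blocks16.blockOf (L ^ (k + 1)) (fun _ : Fin (d + 1) => N) j.1) - cS)), ‖a' j‖) := by
  classical
  have hL1 : 1 ≤ L := by omega
  have hflat0 : SmallField (flat (d := d + 1) (n := n)) 0 := by rw [← flatCfg_eq_flat]; exact smallField_flatCfg_zero
  set C₄ : ℝ := 1 + 2 * ((d + 1 : ℕ) : ℝ) * (2 * ((((d + 1 : ℕ) : ℝ)) * L)) with hC₄
  have hC₄pos : (0 : ℝ) ≤ 2 * ((d + 1 : ℕ) : ℝ) * (2 * ((((d + 1 : ℕ) : ℝ)) * L)) := by positivity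
  have hC₄1 : 1 ≤ C₄ := by rw [hC₄]; linarith
  have hC₄0 : 0 ≤ C₄ := by linarith
  set Sf := (Finset.univ : Finset (Tor (fine (L ^ (k + 1)) (fun _ : Fin (d + 1) => N)) × Fin (d + 1))).filter
    (fun j => ℓ ≤ torusSupNorm (fun _ : Fin (d + 1) => N)
      (rep (fun _ : Fin (d + 1) => N) (B5Blocks16.blockOf (L ^ (k + 1)) (fun _ : Fin (d + 1) => N) j.1) - cS)) with hSfdef
  have hca : QvOp (L ^ (k + 1)) (fun _ : Fin (d + 1) => N) *ᵥ (c • a') = 0 := by rw [Matrix.mulVec_smul, ha', smul_zero]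
  -- the test direction of `c·a′` and its LOCAL tangent correction
  set Y₁ : Site (d + 1) → Fin (d + 1) → Matrix n n ℂ := fun (x : Site (d + 1)) (κ : Fin (d + 1)) =>
      Matrix.single i i' ((c • a') (toT (fine (L ^ (k + 1)) (fun _ : Fin (d + 1) => N)) x, κ))
        - Matrix.single i' i (star ((c • a') (toT (fine (L ^ (k + 1)) (fun _ : Fin (d + 1) => N)) x, κ))) with hY₁def
  have hY₁s : IsSkewDir Y₁ := isSkewDir_test (fine (L ^ (k + 1)) (fun _ : Fin (d + 1) => N)) (c • a') i i'
  have hY₁P : IsPeriodicDir Y₁ ((L ^ (k + 1) * N : ℕ) : ℤ) := isPeriodicDir_test (d := d + 1) (L ^ (k + 1) * N) (c • a') i i'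
  have hY₁Q := Qcoarse_iterate_test_eq_zero (d := d + 1) L k N (c • a') hca i i'
  obtain ⟨Y, hYs, hYP, hYT, hYcurl, hYl1⟩ := exists_tangent_of_straight_zero_local (d := d + 1) (n := n) hL k hY₁s hY₁P hY₁Q
  -- the hypothesis on `Y`, read on the test direction (same flat curl)
  have hsY : |hess (flat (d := d + 1) (n := n)) X Y₁ (perWin (d + 1) (L ^ (k + 1) * N))| ≤ a * dirL1 Y Bn + b * dirL1 Y Bf := by
    have h := hsrc Y hYs hYP hYT
    rw [hess_flat hflat0] at h ⊢
    rw [Finset.sum_congr rfl fun p _ => by unfold T4AveragingDeficitWall.curl; rw [← hYcurl p.1 p.2.1.1 p.2.1.2]]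
    exact h
  -- pointwise size of the test direction on any set of sites
  have htest : ∀ B : Finset (Site (d + 1)), dirL1 Y₁ B ≤ 2 * Fintype.card n * ∑ x ∈ B, ∑ κ : Fin (d + 1),
      ‖a' (toT (fine (L ^ (k + 1)) (fun _ : Fin (d + 1) => N)) x, κ)‖ := by
    intro B
    unfold dirL1
    rw [Finset.mul_sum]
    refine Finset.sum_le_sum fun x _ => ?_
    rw [Finset.mul_sum]
    refine Finset.sum_le_sum fun κ _ => ?_
    have h := norm_test_le (fine (L ^ (k + 1)) (fun _ : Fin (d + 1) => N)) (c • a') i i' x κ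
    have hca1 : ‖(c • a') (toT (fine (L ^ (k + 1)) (fun _ : Fin (d + 1) => N)) x, κ)‖ = ‖a' (toT (fine (L ^ (k + 1)) (fun _ : Fin (d + 1) => N)) x, κ)‖ := by
      rw [Pi.smul_apply, norm_smul, hc, one_mul]
    rw [hca1] at h
    simp only [hY₁def]
    linarith
  -- the NEAR norm, bounded globally: `‖Y‖_{1,Bn} ≤ ‖Y‖_{1,periodBox} ≤ C₄·2card n·‖a′‖₁`
  have hcorner0 : ∀ (B : Finset (Site (d + 1))), 0 ≤ ∑ x ∈ B, ∑ κ : Fin (d + 1),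
      (‖(fun x : Site (d + 1) => if ∀ i, ((L ^ (k + 1) : ℕ) : ℤ) ∣ x i then framePot L (k + 1) Y₁ (fun i => x i / ((L ^ (k + 1) : ℕ) : ℤ)) else 0) (x + e κ)‖
        + ‖(fun x : Site (d + 1) => if ∀ i, ((L ^ (k + 1) : ℕ) : ℤ) ∣ x i then framePot L (k + 1) Y₁ (fun i => x i / ((L ^ (k + 1) : ℕ) : ℤ)) else 0) x‖) :=
    fun B => Finset.sum_nonneg fun _ _ => Finset.sum_nonneg fun _ _ => by positivity
  have hmonoY : ∀ {B B' : Finset (Site (d + 1))}, B ⊆ B' → dirL1 Y B ≤ dirL1 Y B' := fun hBB' =>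
    Finset.sum_le_sum_of_subset_of_nonneg hBB' fun _ _ _ => Finset.sum_nonneg fun _ _ => norm_nonneg _
  have hmono1 : ∀ {B B' : Finset (Site (d + 1))}, B ⊆ B' → dirL1 Y₁ B ≤ dirL1 Y₁ B' := fun hBB' =>
    Finset.sum_le_sum_of_subset_of_nonneg hBB' fun _ _ _ => Finset.sum_nonneg fun _ _ => norm_nonneg _
  -- the whole period box is «far» at threshold `−(nbRad + 1)`
  have hall : periodBox (d := d + 1) (L ^ (k + 1) * N)
      ⊆ (periodBox (d := d + 1) (L ^ (k + 1) * N)).filter (fun x => (-((nbRad (d + 1) L : ℝ)) - 1) + nbRad (d + 1) L + 1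
          ≤ torusSupNorm (fun _ : Fin (d + 1) => N) ((fun i => x i / ((L ^ (k + 1) : ℕ) : ℤ)) - cS)) := by
    intro x hx
    rw [Finset.mem_filter]
    refine ⟨hx, ?_⟩
    have := torusSupNorm_nonneg (N := fun _ : Fin (d + 1) => N) (fun _ => Nat.one_le_iff_ne_zero.mpr (NeZero.ne N))
      ((fun i => x i / ((L ^ (k + 1) : ℕ) : ℤ)) - cS)
    linarith
  have hglob := corner_cost_far_le (n := n) N hd hL k hY₁P cS (-((nbRad (d + 1) L : ℝ)) - 1)
  have hYl1_near : dirL1 Y Bn ≤ C₄ * (2 * Fintype.card n * ∑ j, ‖a' j‖) := by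
    have h1 := (hmonoY hBn).trans ((hmonoY hall).trans (hYl1 _))
    -- `‖Y₁‖` and the corner cost on the full far filter
    have h2 : dirL1 Y₁ ((periodBox (d := d + 1) (L ^ (k + 1) * N)).filter (fun x => (-((nbRad (d + 1) L : ℝ)) - 1) + nbRad (d + 1) L + 1
          ≤ torusSupNorm (fun _ : Fin (d + 1) => N) ((fun i => x i / ((L ^ (k + 1) : ℕ) : ℤ)) - cS)))
        ≤ 2 * Fintype.card n * ∑ j, ‖a' j‖ := by
      refine (hmono1 (Finset.filter_subset _ _)).trans ((htest _).trans ?_)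
      refine mul_le_mul_of_nonneg_left ?_ (by positivity)
      have hfull := sum_far_norm_pull_eq (d := d) (L ^ (k + 1)) N a' cS (-((nbRad (d + 1) L : ℝ)) - 1)
      calc ∑ x ∈ periodBox (d := d + 1) (L ^ (k + 1) * N), ∑ κ : Fin (d + 1), ‖a' (toT (fine (L ^ (k + 1)) (fun _ : Fin (d + 1) => N)) x, κ)‖
          = ∑ x ∈ (periodBox (d := d + 1) (L ^ (k + 1) * N)).filter (fun x => (-((nbRad (d + 1) L : ℝ)) - 1)
              ≤ torusSupNorm (fun _ : Fin (d + 1) => N) ((fun i => x i / ((L ^ (k + 1) : ℕ) : ℤ)) - cS)),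
              ∑ κ : Fin (d + 1), ‖a' (toT (fine (L ^ (k + 1)) (fun _ : Fin (d + 1) => N)) x, κ)‖ := by
            rw [Finset.filter_true_of_mem]
            intro x _
            have := torusSupNorm_nonneg (N := fun _ : Fin (d + 1) => N) (fun _ => Nat.one_le_iff_ne_zero.mpr (NeZero.ne N))
              ((fun i => x i / ((L ^ (k + 1) : ℕ) : ℤ)) - cS)
            have h0 : (0 : ℝ) ≤ nbRad (d + 1) L := by positivity
            linarith
        _ = _ := by push_cast at hfull ⊢; exact hfull
        _ ≤ ∑ j, ‖a' j‖ := Finset.sum_le_univ_sum_of_nonneg fun _ => norm_nonneg _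
    have h3 : ∑ y ∈ (periodBox (d := d + 1) (L ^ (k + 1) * N)).filter
          (fun y => (-((nbRad (d + 1) L : ℝ)) - 1) ≤ torusSupNorm (fun _ : Fin (d + 1) => N) ((fun i => y i / ((L ^ (k + 1) : ℕ) : ℤ)) - cS)),
          ∑ μ : Fin (d + 1), ‖Y₁ y μ‖ ≤ 2 * Fintype.card n * ∑ j, ‖a' j‖ := by
      have : dirL1 Y₁ ((periodBox (d := d + 1) (L ^ (k + 1) * N)).filter
          (fun y => (-((nbRad (d + 1) L : ℝ)) - 1) ≤ torusSupNorm (fun _ : Fin (d + 1) => N) ((fun i => y i / ((L ^ (k + 1) : ℕ) : ℤ)) - cS)))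
          ≤ 2 * Fintype.card n * ∑ j, ‖a' j‖ := by
        refine (hmono1 (Finset.filter_subset _ _)).trans ((htest _).trans (mul_le_mul_of_nonneg_left ?_ (by positivity)))
        calc ∑ x ∈ periodBox (d := d + 1) (L ^ (k + 1) * N), ∑ κ : Fin (d + 1), ‖a' (toT (fine (L ^ (k + 1)) (fun _ : Fin (d + 1) => N)) x, κ)‖
            ≤ ∑ x ∈ periodBox (d := d + 1) (L ^ (k + 1) * N), ∑ κ : Fin (d + 1), ‖a' (toT (fine (L ^ (k + 1)) (fun _ : Fin (d + 1) => N)) x, κ)‖ := le_rfl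
          _ = ∑ j, ‖a' j‖ := by
              have h := sum_periodBox_toT (d := d + 1) (L ^ (k + 1) * N) (fun t => ((∑ κ : Fin (d + 1), ‖a' (t, κ)‖ : ℝ) : ℂ))
              rw [Fintype.sum_prod_type]
              exact_mod_cast h
      unfold dirL1 at this
      exact this
    have hd0 : (0 : ℝ) ≤ 2 * ((d + 1 : ℕ) : ℝ) * (2 * ((((d + 1 : ℕ) : ℝ)) * L)) := by positivity
    calc dirL1 Y Bn ≤ _ := h1
      _ ≤ 2 * Fintype.card n * ∑ j, ‖a' j‖ + 2 * ((d + 1 : ℕ) : ℝ) * (2 * ((((d + 1 : ℕ) : ℝ)) * L)) * (2 * Fintype.card n * ∑ j, ‖a' j‖) := by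
          nlinarith [h2, h3, hglob, mul_le_mul_of_nonneg_left h3 hd0]
      _ = C₄ * (2 * Fintype.card n * ∑ j, ‖a' j‖) := by rw [hC₄]; ring
  -- the FAR norm: far test fields pay far mass
  have hBf' : Bf ⊆ (periodBox (d := d + 1) (L ^ (k + 1) * N)).filter (fun x => ℓ + nbRad (d + 1) L + 1
      ≤ torusSupNorm (fun _ : Fin (d + 1) => N) ((fun i => x i / ((L ^ (k + 1) : ℕ) : ℤ)) - cS)) := by
    intro x hx
    exact Finset.mem_filter.mpr ⟨hBf hx, hfar x hx⟩
  have hsubfar : (periodBox (d := d + 1) (L ^ (k + 1) * N)).filter (fun x => ℓ + nbRad (d + 1) L + 1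
      ≤ torusSupNorm (fun _ : Fin (d + 1) => N) ((fun i => x i / ((L ^ (k + 1) : ℕ) : ℤ)) - cS))
      ⊆ (periodBox (d := d + 1) (L ^ (k + 1) * N)).filter (fun x => ℓ
          ≤ torusSupNorm (fun _ : Fin (d + 1) => N) ((fun i => x i / ((L ^ (k + 1) : ℕ) : ℤ)) - cS)) := by
    intro x hx
    rw [Finset.mem_filter] at hx ⊢
    have h0 : (0 : ℝ) ≤ nbRad (d + 1) L := by positivity
    exact ⟨hx.1, by linarith [hx.2]⟩
  have hfarcost := corner_cost_far_le (n := n) N hd hL k hY₁P cS ℓ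
  have hYl1_far : dirL1 Y Bf ≤ C₄ * (2 * Fintype.card n * ∑ j ∈ Sf, ‖a' j‖) := by
    have h1 := (hmonoY hBf').trans (hYl1 _)
    have hpull := sum_far_norm_pull_eq (d := d) (L ^ (k + 1)) N a' cS ℓ
    have h2 : dirL1 Y₁ ((periodBox (d := d + 1) (L ^ (k + 1) * N)).filter (fun x => ℓ + nbRad (d + 1) L + 1
          ≤ torusSupNorm (fun _ : Fin (d + 1) => N) ((fun i => x i / ((L ^ (k + 1) : ℕ) : ℤ)) - cS)))
        ≤ 2 * Fintype.card n * ∑ j ∈ Sf, ‖a' j‖ := by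
      refine (hmono1 hsubfar).trans ((htest _).trans (le_of_eq ?_))
      rw [hSfdef]
      push_cast at hpull ⊢
      rw [hpull]
    have h3 : ∑ y ∈ (periodBox (d := d + 1) (L ^ (k + 1) * N)).filter
          (fun y => ℓ ≤ torusSupNorm (fun _ : Fin (d + 1) => N) ((fun i => y i / ((L ^ (k + 1) : ℕ) : ℤ)) - cS)),
          ∑ μ : Fin (d + 1), ‖Y₁ y μ‖ ≤ 2 * Fintype.card n * ∑ j ∈ Sf, ‖a' j‖ := by
      have := (htest ((periodBox (d := d + 1) (L ^ (k + 1) * N)).filter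
          (fun y => ℓ ≤ torusSupNorm (fun _ : Fin (d + 1) => N) ((fun i => y i / ((L ^ (k + 1) : ℕ) : ℤ)) - cS))))
      unfold dirL1 at this
      refine this.trans (le_of_eq ?_)
      rw [hSfdef]
      push_cast at hpull ⊢
      rw [hpull]
    have hd0 : (0 : ℝ) ≤ 2 * ((d + 1 : ℕ) : ℝ) * (2 * ((((d + 1 : ℕ) : ℝ)) * L)) := by positivity
    have hS0 : 0 ≤ ∑ j ∈ Sf, ‖a' j‖ := Finset.sum_nonneg fun _ _ => norm_nonneg _
    calc dirL1 Y Bf ≤ _ := h1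
      _ ≤ 2 * Fintype.card n * ∑ j ∈ Sf, ‖a' j‖ + 2 * ((d + 1 : ℕ) : ℝ) * (2 * ((((d + 1 : ℕ) : ℝ)) * L)) * (2 * Fintype.card n * ∑ j ∈ Sf, ‖a' j‖) := by
          nlinarith [h2, h3, hfarcost, mul_le_mul_of_nonneg_left h3 hd0]
      _ = C₄ * (2 * Fintype.card n * ∑ j ∈ Sf, ‖a' j‖) := by rw [hC₄]; ring
  -- G3a: the Hessian against the test direction is `(2/card n)·Re(conj c·S)`
  rw [hY₁def, hess_flat_test (d := d + 1) (P := L ^ (k + 1) * N) hXs hXP (c • a') i i'] at hsY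
  have hS : ∑ p ∈ perWin (d + 1) (L ^ (k + 1) * N),
      conj (Fs (fun _ : Fin (d + 1) => L ^ (k + 1) * N) 1 (c • a') p.2.1.1 p.2.1.2 (toT (fun _ : Fin (d + 1) => L ^ (k + 1) * N) p.1))
        * Fs (fun _ : Fin (d + 1) => L ^ (k + 1) * N) 1
            (fun q : Tor (fun _ : Fin (d + 1) => L ^ (k + 1) * N) × Fin (d + 1) => X (rep (fun _ : Fin (d + 1) => L ^ (k + 1) * N) q.1) q.2 i i')
            p.2.1.1 p.2.1.2 (toT (fun _ : Fin (d + 1) => L ^ (k + 1) * N) p.1)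
      = conj c * ∑ p ∈ perWin (d + 1) (L ^ (k + 1) * N),
        conj (Fs (fun _ : Fin (d + 1) => L ^ (k + 1) * N) 1 a' p.2.1.1 p.2.1.2 (toT (fun _ : Fin (d + 1) => L ^ (k + 1) * N) p.1))
          * Fs (fun _ : Fin (d + 1) => L ^ (k + 1) * N) 1
              (fun q : Tor (fun _ : Fin (d + 1) => L ^ (k + 1) * N) × Fin (d + 1) => X (rep (fun _ : Fin (d + 1) => L ^ (k + 1) * N) q.1) q.2 i i')
              p.2.1.1 p.2.1.2 (toT (fun _ : Fin (d + 1) => L ^ (k + 1) * N) p.1) := by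
    rw [Finset.mul_sum]
    refine Finset.sum_congr rfl fun p _ => ?_
    rw [Fs_one_smul, map_mul, mul_assoc]
  rw [hS] at hsY
  have hcardpos : (0 : ℝ) < Fintype.card n := by exact_mod_cast Fintype.card_pos
  have key : |2 / Fintype.card n * (conj c * _).re| ≤ a * (C₄ * (2 * Fintype.card n * ∑ j, ‖a' j‖)) + b * (C₄ * (2 * Fintype.card n * ∑ j ∈ Sf, ‖a' j‖)) :=
    hsY.trans (add_le_add (mul_le_mul_of_nonneg_left hYl1_near ha) (mul_le_mul_of_nonneg_left hYl1_far hb))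
  rw [abs_mul, abs_of_pos (by positivity : (0 : ℝ) < 2 / Fintype.card n)] at key
  refine le_of_mul_le_mul_left (key.trans (le_of_eq ?_)) (by positivity : (0 : ℝ) < 2 / Fintype.card n)
  field_simp

end

end Summit.QuantumFields.BalabanUV.T4Continuum.NE7SliceGreenPairingLocalised
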